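/-
Copyright: fleet lead `ym-wcr-19609-p1` (seat prover-ym-wcr-19609-p1-g0-0), route `WeakCouplingRates`, crux
`BulkDominatesColdBoxW` (stmt-QuantumFields-19609), line `dlr-chessboard` v2 (skeleton sha16 021c654069d76526).
-/
import Summits.QuantumFields.YangMills.Theorems.WeakCouplingRatesLargeFieldTail
import Summits.QuantumFields.YangMills.Theorems.SoloBlindExpMoment
import Summits.QuantumFields.YangMills.Theorems.LangevinControlUVFemtoCurvatureTwoPointStubDoublingOfRV

/-!
# The single-plaquette large-field tail of the `SU(2)₄` Wilson torus states, uniformly in the volume —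
# ALL torus sides (stub L2 `stub_largeFieldRarity` of the DLR–chessboard line for crux BULK_W of route `WeakCouplingRates`)

WHAT.  For the Wilson measure of `SU(2)` (fundamental character) on the torus `(ℤ/Lℤ)⁴`, `β ≥ 1`:

* `su2_measureReal_plaqCost_ge_le_odd` — the Peierls–chessboard tail `μ{U : s ≤ 2 − Re tr U_p} ≤ C·β^κ·exp(−β s/2)`
  for every plaquette, every `s ≥ 0`, every ODD `L ≥ 3`, ONE constant `C` and ONE power `κ`.  Route to it:
  Chebyshev `μ{s ≤ φ_p} ≤ e^{−βs/2} ⟨e^{(β/2)φ_p}⟩`; the tree's iterated site-reflection-positivity doubling on the odd torus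
  (`SoloBlind.wilsonExpectation_exp_plaquetteCost_le`: `⟨e^{cφ_p}⟩ ≤ exp((4/L)⁴ (log Z_L(β−c) − log Z_L(β)))`, the
  odd-torus replacement of the Fröhlich–Israel–Lieb–Simon chessboard estimate); and the crude partition-function bounds
  `log Z_L(β/2) ≤ 0`, `log Z_L(β) ≥ −48 L⁴ + 4L⁴ log(C₁ β^{−D/2})` (Gaussian-scale link balls, tree
  `FemtoCurvatureTwoPoint.DoublingOfRV.partitionFunction_toReal_ge_inv_sqrt_pow`), so that the exponent is volume-free:
  `(4/L)⁴ · L⁴ · (48 − 4 log C₁ + 2D log β)`.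
* `su2_measureReal_plaqCost_ge_le_allSides` — the same shape for EVERY `L ≥ 2` (even sides: the tree's
  `su2_measureReal_plaqCost_ge_le`, reflection positivity in link planes + chessboard).
* `plaquetteLargeFieldRarity_allSides` — **L2 for all torus sides**: for `0 < δ` there is `β₀` with
  `wilsonExpectation_{(L+1)⁴} 𝟙{β^{2δ−1} ≤ plaqCostAt ρ x i j} ≤ exp(−β^δ)` for all `β ≥ β₀`, ALL `L ≥ 1`, all sites `x`
  and planes `i ≠ j` (observable read through the periodic lift, as in `torusPlaqCov`); and its `∀ᶠ L` form
  `plaquetteLargeFieldRarity_eventually`, which is literally the body of the line's predicate `PlaquetteLargeFieldRarity δ`.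

WHAT THIS IS NOT.  Not a statement about the mass gap; a large-field RARITY bound (probability of ONE plaquette
deviation above the Gaussian scale `β^{−1/2}`), uniform in the volume, nothing about decoupling.

References: [FrohlichIsraelLiebSimon1978] Thm. 4.1 (chessboard estimate); E. Seiler, LNP 159 (1982) Ch. 4;
K. Osterwalder, E. Seiler, Ann. Phys. 110 (1978) §2 (site reflections).
-/

set_option autoImplicit false

noncomputable section

open MeasureTheory Filter Topology
open Literature.MathematicalPhysics
open Literature.MathematicalPhysics.QuantumFieldTheory
open Literature.MathematicalPhysics.QuantumLattice
open Literature.Probability.LatticeModels (Torus.proj)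

namespace Summit.QuantumFields.YangMills.Theorems.WeakCouplingRates

/-! ### Two elementary lemmas -/

/-- Chebyshev's exponential inequality for a bounded measurable `φ` under a probability measure:
`μ{s ≤ φ} ≤ e^{−cs} ∫ e^{cφ} dμ` for `c ≥ 0`. [folklore] -/
theorem measureReal_le_exp_mul_integral_exp {Ω : Type*} [MeasurableSpace Ω] (μ : Measure Ω)
    [IsProbabilityMeasure μ] {φ : Ω → ℝ} (hφ : Measurable φ) {K : ℝ} (hK : ∀ ω, |φ ω| ≤ K) {c : ℝ}
    (hc : 0 ≤ c) (s : ℝ) :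
    μ.real {ω | s ≤ φ ω} ≤ Real.exp (-(c * s)) * ∫ ω, Real.exp (c * φ ω) ∂μ := by
  have hSm : MeasurableSet {ω | s ≤ φ ω} := measurableSet_le measurable_const hφ
  rw [← integral_indicator_one hSm, ← integral_const_mul]
  have hint : Integrable (fun ω => Real.exp (-(c * s)) * Real.exp (c * φ ω)) μ := by
    refine Integrable.of_bound (C := Real.exp (-(c * s)) * Real.exp (c * K)) ?_ (ae_of_all _ fun ω => ?_)
    · exact ((Real.measurable_exp.comp (hφ.const_mul c)).const_mul _).aestronglyMeasurable
    · rw [Real.norm_eq_abs, abs_mul, Real.abs_exp, Real.abs_exp]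
      refine mul_le_mul_of_nonneg_left (Real.exp_le_exp.2 ?_) (Real.exp_pos _).le
      exact mul_le_mul_of_nonneg_left ((le_abs_self _).trans (hK ω)) hc
  refine integral_mono ((integrable_const (1 : ℝ)).indicator hSm) hint fun ω => ?_
  by_cases hω : ω ∈ {ω | s ≤ φ ω}
  · rw [Set.indicator_of_mem hω, Pi.one_apply, ← Real.exp_add]
    have hs : s ≤ φ ω := hω
    exact Real.one_le_exp (by nlinarith [mul_le_mul_of_nonneg_left hs hc])
  · rw [Set.indicator_of_notMem hω]
    positivity

/-- Elementary asymptotics with a general power: `C β^κ exp(−β·β^{2δ−1}/2) ≤ exp(−β^δ)` for `β ≥ β₀(δ, C, κ)`.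
[folklore] -/
theorem poly_exp_tail_le_pow {δ : ℝ} (hδ : 0 < δ) {C : ℝ} (hC : 0 < C) (κ : ℕ) :
    ∃ β₀ : ℝ, 1 ≤ β₀ ∧ ∀ β : ℝ, β₀ ≤ β →
      C * β ^ κ * Real.exp (-(β * β ^ (2 * δ - 1) / 2)) ≤ Real.exp (-(β ^ δ)) := by
  have h1 : Tendsto (fun β : ℝ => β ^ δ) atTop atTop := tendsto_rpow_atTop hδ
  have h2 : Tendsto (fun u : ℝ => u ^ ((κ : ℝ) / δ) * Real.exp (-1 * u)) atTop (𝓝 0) :=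
    tendsto_rpow_mul_exp_neg_mul_atTop_nhds_zero _ _ one_pos
  have hε : (0 : ℝ) < 1 / (C + 1) := by positivity
  have h3 : ∀ᶠ β : ℝ in atTop, (β ^ δ) ^ ((κ : ℝ) / δ) * Real.exp (-1 * β ^ δ) ≤ 1 / (C + 1) :=
    (h2.comp h1).eventually (Iic_mem_nhds hε)
  have h4 : ∀ᶠ β : ℝ in atTop, 4 ≤ β ^ δ := h1.eventually_ge_atTop 4
  obtain ⟨b, hb⟩ := Filter.eventually_atTop.1 (h3.and h4)
  refine ⟨max b 1, le_max_right _ _, fun β hβ => ?_⟩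
  have hβb : b ≤ β := (le_max_left _ _).trans hβ
  have hβ1 : 1 ≤ β := (le_max_right _ _).trans hβ
  have hβ0 : 0 < β := by linarith
  obtain ⟨h3β, h4β⟩ := hb β hβb
  have e1 : (β ^ δ) ^ ((κ : ℝ) / δ) = β ^ κ := by
    have h6 : δ * ((κ : ℝ) / δ) = ((κ : ℕ) : ℝ) := by field_simp
    rw [← Real.rpow_mul hβ0.le, h6, Real.rpow_natCast]
  have e2 : β * β ^ (2 * δ - 1) = (β ^ δ) ^ (2 : ℕ) := by
    rw [← Real.rpow_natCast (β ^ δ) 2, ← Real.rpow_mul hβ0.le, Nat.cast_ofNat,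
      show δ * 2 = 1 + (2 * δ - 1) by ring, Real.rpow_add hβ0, Real.rpow_one]
  rw [e1] at h3β
  rw [e2]
  set u := β ^ δ with hu
  have hexp : Real.exp (-(u ^ (2 : ℕ) / 2)) ≤ Real.exp (-u) * Real.exp (-u) := by
    rw [← Real.exp_add]
    exact Real.exp_le_exp.2 (by nlinarith)
  have hx : β ^ κ * Real.exp (-u) ≤ 1 / (C + 1) := by simpa [neg_mul, one_mul] using h3β
  have hCle : C * β ^ κ * Real.exp (-u) ≤ 1 := by
    calc C * β ^ κ * Real.exp (-u) = C * (β ^ κ * Real.exp (-u)) := by ring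
      _ ≤ C * (1 / (C + 1)) := mul_le_mul_of_nonneg_left hx hC.le
      _ ≤ 1 := by rw [mul_one_div]; exact (div_le_one (by positivity)).2 (by linarith)
  have hpos : 0 ≤ C * β ^ κ := by positivity
  calc C * β ^ κ * Real.exp (-(u ^ (2 : ℕ) / 2))
      ≤ C * β ^ κ * (Real.exp (-u) * Real.exp (-u)) := mul_le_mul_of_nonneg_left hexp hpos
    _ = (C * β ^ κ * Real.exp (-u)) * Real.exp (-u) := by ring
    _ ≤ 1 * Real.exp (-u) := mul_le_mul_of_nonneg_right hCle (Real.exp_pos _).le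
    _ = Real.exp (-u) := one_mul _

/-! ### Crude partition-function bounds for `SU(2)` -/

/-- `log Z_L(β) ≤ 0` for `β ≥ 0`: the Wilson action of `SU(2)` is non-negative and product Haar measure is a
probability measure. [folklore] -/
theorem su2_torusLogPartition_nonpos {L : ℕ} [NeZero L] {β : ℝ} (hβ : 0 ≤ β) :
    torusLogPartition 4 (G := Matrix.specialUnitaryGroup (Fin 2) ℂ) (fundamentalRep (Fin 2)) β L ≤ 0 := by
  set ρ := fundamentalRep (Fin 2) with hρdef
  have hρc : Continuous ρ := continuous_fundamentalRep (Fin 2)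
  set π₀ : Measure (GaugeConfig 4 L (Matrix.specialUnitaryGroup (Fin 2) ℂ)) :=
    Measure.pi fun _ : Edge 4 L => haarProbability (Matrix.specialUnitaryGroup (Fin 2) ℂ) with hπ₀
  rw [torusLogPartition_eq_log_integral ρ hρc β]
  have hle : ∫ U, Real.exp (-β * wilsonAction ρ U) ∂π₀ ≤ 1 := by
    calc ∫ U, Real.exp (-β * wilsonAction ρ U) ∂π₀ ≤ ∫ _U, (1 : ℝ) ∂π₀ := by
          refine integral_mono (integrable_exp_mul_wilsonAction ρ hρc (-β) π₀) (integrable_const _) fun U => ?_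
          have hS : 0 ≤ wilsonAction ρ U := wilsonAction_nonneg_of_re_trace_le ρ trace_re_le_two U
          rw [Real.exp_le_one_iff]
          nlinarith
      _ = 1 := by rw [integral_const, probReal_univ, one_smul]
  exact Real.log_nonpos (integral_exp_neg_mul_wilsonAction_pos ρ hρc β).le hle

/-- **Crude Gaussian lower bound for `log Z_L(β)` of `SU(2)`**, uniformly in `L`: there are `C₁ > 0` and `D : ℕ` with
`−48 L⁴ + 4 L⁴ (log C₁ − (D/2) log β) ≤ log Z_L(β)` for all `L` and `β ≥ 1` (all links in the ball of radius `β^{−1/2}`;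
tree `FemtoCurvatureTwoPoint.DoublingOfRV.partitionFunction_toReal_ge_inv_sqrt_pow`). [folklore] -/
theorem su2_torusLogPartition_lower :
    ∃ C₁ : ℝ, 0 < C₁ ∧ ∃ D : ℕ, ∀ (L : ℕ) [NeZero L] (β : ℝ), 1 ≤ β →
      -(48 * (L : ℝ) ^ 4) + 4 * (L : ℝ) ^ 4 * (Real.log C₁ - (D : ℝ) / 2 * Real.log β) ≤
        torusLogPartition 4 (G := Matrix.specialUnitaryGroup (Fin 2) ℂ) (fundamentalRep (Fin 2)) β L := by
  obtain ⟨C₁, hC₁, h⟩ :=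
    FemtoCurvatureTwoPoint.DoublingOfRV.partitionFunction_toReal_ge_inv_sqrt_pow (fundamentalLatticeRep 2)
  refine ⟨C₁, hC₁, FreeEnergyLogCoefficient.dimE (fundamentalLatticeRep 2).ρ, fun L _ β hβ => ?_⟩
  set D : ℕ := FreeEnergyLogCoefficient.dimE (fundamentalLatticeRep 2).ρ with hD
  have hβ0 : 0 < β := by linarith
  have hs0 : 0 < Real.sqrt β := Real.sqrt_pos.2 hβ0
  have hmain := h L β hβ
  have hpos : 0 < Real.exp (-(48 * (L : ℝ) ^ 4)) * (C₁ * (Real.sqrt β)⁻¹ ^ D) ^ (4 * L ^ 4) := by positivity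
  have hlog := Real.log_le_log hpos hmain
  have hx : 0 < C₁ * (Real.sqrt β)⁻¹ ^ D := by positivity
  rw [Real.log_mul (Real.exp_pos _).ne' (pow_pos hx _).ne', Real.log_exp, Real.log_pow,
    Real.log_mul hC₁.ne' (pow_pos (inv_pos.2 hs0) _).ne', Real.log_pow, Real.log_inv,
    Real.log_sqrt hβ0.le] at hlog
  have e : -(48 * (L : ℝ) ^ 4) + ((4 * L ^ 4 : ℕ) : ℝ) * (Real.log C₁ + (D : ℝ) * -(Real.log β / 2)) =
      -(48 * (L : ℝ) ^ 4) + 4 * (L : ℝ) ^ 4 * (Real.log C₁ - (D : ℝ) / 2 * Real.log β) := by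
    push_cast; ring
  rw [e] at hlog
  exact hlog

/-! ### The odd-side single-plaquette tail -/

/-- **The single-plaquette energy tail of the `SU(2)` Wilson torus, uniformly in the ODD volume**:
`μ_{L,β}{U : s ≤ 2 − Re tr U_p} ≤ C β^κ exp(−β s/2)` for `β ≥ 1`, `s ≥ 0`, `L ≥ 3` odd, every plaquette `p = (x; i, j)`,
ONE constant `C` and ONE power `κ` — Chebyshev with `e^{(β/2)φ_p}`, the odd-torus chessboard doubling
`SoloBlind.wilsonExpectation_exp_plaquetteCost_le`, and the crude partition-function bounds above.
[cite: FrohlichIsraelLiebSimon1978, Thm. 4.1] -/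
theorem su2_measureReal_plaqCost_ge_le_odd :
    ∃ C : ℝ, 0 < C ∧ ∃ κ : ℕ, ∀ {L : ℕ} [NeZero L], Odd L → 3 ≤ L → ∀ (β : ℝ), 1 ≤ β → ∀ (s : ℝ), 0 ≤ s →
      ∀ (x : Site 4 L) {i j : Fin 4}, i ≠ j →
        (wilsonMeasure (d := 4) (L := L) (fundamentalRep (Fin 2)) β).real
            {U : GaugeConfig 4 L (Matrix.specialUnitaryGroup (Fin 2) ℂ) |
              s ≤ 2 - (fundamentalRep (Fin 2) (plaquetteHolonomy U x i j)).trace.re} ≤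
          C * β ^ κ * Real.exp (-(β * s / 2)) := by
  obtain ⟨C₁, hC₁, D, hZ⟩ := su2_torusLogPartition_lower
  refine ⟨Real.exp (12288 - 1024 * Real.log C₁), Real.exp_pos _, 512 * D, ?_⟩
  intro L _ hL hL3 β hβ s _ x i j hij
  set ρ := fundamentalRep (Fin 2) with hρdef
  have hρc : Continuous ρ := continuous_fundamentalRep (Fin 2)
  have hβ0 : 0 < β := lt_of_lt_of_le one_pos hβ
  haveI := isProbabilityMeasure_wilsonMeasure (d := 4) (L := L) ρ hρc β
  -- orient the plaquette: `i < j` or `j < i`, the cost is symmetric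
  obtain ⟨p, hp⟩ : ∃ p : Plaquette 4 L, ∀ U : GaugeConfig 4 L (Matrix.specialUnitaryGroup (Fin 2) ℂ),
      SoloBlind.plaquetteCost ρ p.1 p.2.1.1 p.2.1.2 U = 2 - (ρ (plaquetteHolonomy U x i j)).trace.re := by
    rcases lt_or_gt_of_ne hij with h | h
    · exact ⟨(x, ⟨(i, j), h⟩), fun U => by simp [SoloBlind.plaquetteCost]⟩
    · refine ⟨(x, ⟨(j, i), h⟩), fun U => ?_⟩
      have hs := SoloBlind.plaquetteCost_symm ρ hρc x i j U
      simp only [SoloBlind.plaquetteCost, Nat.cast_ofNat] at hs ⊢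
      exact hs
  -- Chebyshev with `c = β/2`
  have hφm : Measurable (SoloBlind.plaquetteCost (G := Matrix.specialUnitaryGroup (Fin 2) ℂ) ρ p.1 p.2.1.1 p.2.1.2) :=
    SoloBlind.measurable_plaquetteCost ρ hρc p
  have hφK : ∀ U : GaugeConfig 4 L (Matrix.specialUnitaryGroup (Fin 2) ℂ),
      |SoloBlind.plaquetteCost ρ p.1 p.2.1.1 p.2.1.2 U| ≤ 2 * (2 : ℕ) := fun U =>
    SoloBlind.abs_plaquetteCost_le ρ hρc _ _ _ U
  have hc : (0 : ℝ) ≤ β / 2 := by linarith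
  have hcheb := measureReal_le_exp_mul_integral_exp (wilsonMeasure (d := 4) (L := L) ρ β) hφm hφK hc s
  have hset : {U : GaugeConfig 4 L (Matrix.specialUnitaryGroup (Fin 2) ℂ) |
        s ≤ SoloBlind.plaquetteCost ρ p.1 p.2.1.1 p.2.1.2 U} =
      {U | s ≤ 2 - (ρ (plaquetteHolonomy U x i j)).trace.re} := by
    ext U; simp only [Set.mem_setOf_eq, hp U]
  rw [hset] at hcheb
  refine hcheb.trans ?_
  -- the odd chessboard bound on the exponential moment
  have hchess := SoloBlind.wilsonExpectation_exp_plaquetteCost_le (d := 4) (L := L) ρ hL hL3 hρc hβ0.le hc p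
  rw [show β - β / 2 = β / 2 by ring] at hchess
  have hexpect : ∫ U, Real.exp (β / 2 * SoloBlind.plaquetteCost ρ p.1 p.2.1.1 p.2.1.2 U)
        ∂(wilsonMeasure (d := 4) (L := L) ρ β) =
      wilsonExpectation ρ β (fun U : GaugeConfig 4 L (Matrix.specialUnitaryGroup (Fin 2) ℂ) =>
        Real.exp (β / 2 * SoloBlind.plaquetteCost ρ p.1 p.2.1.1 p.2.1.2 U)) := rfl
  rw [hexpect]
  -- the exponent is volume-free
  have hL0 : (0 : ℝ) < (L : ℝ) ^ 4 := by
    have : (0 : ℝ) < L := by exact_mod_cast (show 0 < L by omega)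
    positivity
  have hup := su2_torusLogPartition_nonpos (L := L) (β := β / 2) hc
  have hlow := hZ L β hβ
  have hE : (4 : ℝ) ^ 4 / (L : ℝ) ^ 4 *
        (torusLogPartition 4 (G := Matrix.specialUnitaryGroup (Fin 2) ℂ) ρ (β / 2) L -
          torusLogPartition 4 (G := Matrix.specialUnitaryGroup (Fin 2) ℂ) ρ β L) ≤
      12288 - 1024 * Real.log C₁ + 512 * (D : ℝ) * Real.log β := by
    have hdiff : torusLogPartition 4 (G := Matrix.specialUnitaryGroup (Fin 2) ℂ) ρ (β / 2) L -
          torusLogPartition 4 (G := Matrix.specialUnitaryGroup (Fin 2) ℂ) ρ β L ≤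
        (L : ℝ) ^ 4 * (48 - 4 * Real.log C₁ + 2 * (D : ℝ) * Real.log β) := by
      nlinarith
    have h44 : (4 : ℝ) ^ 4 = 256 := by norm_num
    calc (4 : ℝ) ^ 4 / (L : ℝ) ^ 4 *
          (torusLogPartition 4 (G := Matrix.specialUnitaryGroup (Fin 2) ℂ) ρ (β / 2) L -
            torusLogPartition 4 (G := Matrix.specialUnitaryGroup (Fin 2) ℂ) ρ β L)
        ≤ (4 : ℝ) ^ 4 / (L : ℝ) ^ 4 * ((L : ℝ) ^ 4 * (48 - 4 * Real.log C₁ + 2 * (D : ℝ) * Real.log β)) :=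
          mul_le_mul_of_nonneg_left hdiff (by positivity)
      _ = 256 * (48 - 4 * Real.log C₁ + 2 * (D : ℝ) * Real.log β) := by
          rw [h44]; field_simp
      _ = 12288 - 1024 * Real.log C₁ + 512 * (D : ℝ) * Real.log β := by ring
  have hmom : wilsonExpectation ρ β (fun U : GaugeConfig 4 L (Matrix.specialUnitaryGroup (Fin 2) ℂ) =>
        Real.exp (β / 2 * SoloBlind.plaquetteCost ρ p.1 p.2.1.1 p.2.1.2 U)) ≤
      Real.exp (12288 - 1024 * Real.log C₁) * β ^ (512 * D) := by
    refine hchess.trans ((Real.exp_le_exp.2 hE).trans (le_of_eq ?_))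
    rw [Real.exp_add, show 512 * (D : ℝ) * Real.log β = ((512 * D : ℕ) : ℝ) * Real.log β by push_cast; ring,
      ← Real.log_pow, Real.exp_log (pow_pos hβ0 _)]
  have e1 : Real.exp (-(β / 2 * s)) = Real.exp (-(β * s / 2)) := by ring_nf
  rw [e1]
  calc Real.exp (-(β * s / 2)) *
        wilsonExpectation ρ β (fun U : GaugeConfig 4 L (Matrix.specialUnitaryGroup (Fin 2) ℂ) =>
          Real.exp (β / 2 * SoloBlind.plaquetteCost ρ p.1 p.2.1.1 p.2.1.2 U))
      ≤ Real.exp (-(β * s / 2)) * (Real.exp (12288 - 1024 * Real.log C₁) * β ^ (512 * D)) :=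
        mul_le_mul_of_nonneg_left hmom (Real.exp_pos _).le
    _ = Real.exp (12288 - 1024 * Real.log C₁) * β ^ (512 * D) * Real.exp (-(β * s / 2)) := by ring

/-! ### All sides -/

/-- **The single-plaquette energy tail of the `SU(2)` Wilson torus, uniformly in the volume, ALL sides `L ≥ 2`**:
`μ_{L,β}{U : s ≤ 2 − Re tr U_p} ≤ C β^κ exp(−β s/2)` for `β ≥ 1`, `s ≥ 0`, every plaquette (even sides: reflection
positivity in link planes + the chessboard estimate, tree `su2_measureReal_plaqCost_ge_le`; odd sides:
`su2_measureReal_plaqCost_ge_le_odd`). [cite: FrohlichIsraelLiebSimon1978, Thm. 4.1] -/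
theorem su2_measureReal_plaqCost_ge_le_allSides :
    ∃ C : ℝ, 0 < C ∧ ∃ κ : ℕ, ∀ {L : ℕ} [NeZero L], 2 ≤ L → ∀ (β : ℝ), 1 ≤ β → ∀ (s : ℝ), 0 ≤ s →
      ∀ (x : Site 4 L) {i j : Fin 4}, i ≠ j →
        (wilsonMeasure (d := 4) (L := L) (fundamentalRep (Fin 2)) β).real
            {U : GaugeConfig 4 L (Matrix.specialUnitaryGroup (Fin 2) ℂ) |
              s ≤ 2 - (fundamentalRep (Fin 2) (plaquetteHolonomy U x i j)).trace.re} ≤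
          C * β ^ κ * Real.exp (-(β * s / 2)) := by
  obtain ⟨Ce, hCe, he⟩ := su2_measureReal_plaqCost_ge_le
  obtain ⟨Co, hCo, κ, ho⟩ := su2_measureReal_plaqCost_ge_le_odd
  refine ⟨max Ce Co, lt_max_of_lt_left hCe, max 6 κ, ?_⟩
  intro L _ hL2 β hβ s hs x i j hij
  haveI : Fact (1 < L) := ⟨by omega⟩
  have hpow : ∀ n : ℕ, n ≤ max 6 κ → β ^ n ≤ β ^ (max 6 κ) := fun n hn => pow_le_pow_right₀ hβ hn
  have hX := (Real.exp_pos (-(β * s / 2))).le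
  rcases Nat.even_or_odd L with hev | hodd
  · refine (he hev β hβ s hs x hij).trans ?_
    have h1 : Ce * β ^ (6 : ℕ) ≤ max Ce Co * β ^ (max 6 κ) :=
      mul_le_mul (le_max_left _ _) (hpow 6 (le_max_left _ _)) (by positivity) (le_trans hCe.le (le_max_left _ _))
    exact mul_le_mul_of_nonneg_right h1 hX
  · have hL3 : 3 ≤ L := by obtain ⟨m, rfl⟩ := hodd; omega
    refine (ho hodd hL3 β hβ s hs x hij).trans ?_
    have h1 : Co * β ^ κ ≤ max Ce Co * β ^ (max 6 κ) :=
      mul_le_mul (le_max_right _ _) (hpow κ (le_max_right _ _)) (by positivity) (le_trans hCe.le (le_max_left _ _))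
    exact mul_le_mul_of_nonneg_right h1 hX

/-- **L2 of the DLR–chessboard line, ALL torus sides**: for `0 < δ` there is `β₀` such that for all `β ≥ β₀`, ALL
`L ≥ 1`, all sites `x` and planes `i ≠ j`, the crude large-field event `{β^{2δ−1} ≤ plaqCostAt ρ x i j}` of the
plaquette `(x; i, j)` has `wilsonExpectation_{(L+1)⁴} ≤ exp(−β^δ)` (observable read through the periodic lift).
[cite: FrohlichIsraelLiebSimon1978, Thm. 4.1] -/
theorem plaquetteLargeFieldRarity_allSides {δ : ℝ} (hδ : 0 < δ) :
    ∃ β₀ : ℝ, ∀ β : ℝ, β₀ ≤ β → ∀ L : ℕ, 1 ≤ L →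
      ∀ (x : Literature.Probability.LatticeModels.Site 4) (i j : Fin 4), i ≠ j →
        wilsonExpectation (L := L + 1) (fundamentalRep (Fin 2)) β
            (toTorusObservable (L + 1) fun U : LGConfig 4 (Matrix.specialUnitaryGroup (Fin 2) ℂ) =>
              if β ^ (2 * δ - 1) ≤ plaqCostAt (fundamentalRep (Fin 2)) x i j U then (1 : ℝ) else 0) ≤
          Real.exp (-(β ^ δ)) := by
  obtain ⟨C, hC, κ, hmain⟩ := su2_measureReal_plaqCost_ge_le_allSides
  obtain ⟨β₀, hβ₀1, hasy⟩ := poly_exp_tail_le_pow hδ hC κ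
  refine ⟨β₀, fun β hβ L hL x i j hij => ?_⟩
  have hβ1 : 1 ≤ β := hβ₀1.trans hβ
  have hβ0 : 0 < β := by linarith
  set ρ := fundamentalRep (Fin 2) with hρdef
  have hρc : Continuous ρ := continuous_fundamentalRep (Fin 2)
  -- the event, on the torus
  set S : Set (GaugeConfig 4 (L + 1) (Matrix.specialUnitaryGroup (Fin 2) ℂ)) :=
    {U | β ^ (2 * δ - 1) ≤ 2 - (ρ (plaquetteHolonomy U (Torus.proj (L + 1) x) i j)).trace.re} with hS
  have hcont : Continuous fun g : (Matrix.specialUnitaryGroup (Fin 2) ℂ) => (ρ g).trace.re :=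
    Complex.continuous_re.comp hρc.matrix_trace
  have hmeas : Measurable fun U : GaugeConfig 4 (L + 1) (Matrix.specialUnitaryGroup (Fin 2) ℂ) =>
      (2 : ℝ) - (ρ (plaquetteHolonomy U (Torus.proj (L + 1) x) i j)).trace.re :=
    (hcont.measurable.comp (measurable_plaquetteHolonomy _ _ _)).const_sub 2
  have hSm : MeasurableSet S := measurableSet_le measurable_const hmeas
  have hind : (toTorusObservable (L + 1) fun U : LGConfig 4 (Matrix.specialUnitaryGroup (Fin 2) ℂ) =>
        if β ^ (2 * δ - 1) ≤ plaqCostAt ρ x i j U then (1 : ℝ) else 0) = S.indicator 1 := by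
    funext U
    simp only [toTorusObservable_apply, hS, Set.indicator_apply, Set.mem_setOf_eq, plaqCostAt, QuantumLattice.plaquetteObs,
      FreeEnergy.plaquetteHolonomyZd_torusLift, Pi.one_apply, Nat.cast_ofNat]
  have hexp : wilsonExpectation (L := L + 1) ρ β (toTorusObservable (L + 1) fun U : LGConfig 4 (Matrix.specialUnitaryGroup (Fin 2) ℂ) =>
        if β ^ (2 * δ - 1) ≤ plaqCostAt ρ x i j U then (1 : ℝ) else 0) = (wilsonMeasure (d := 4) (L := L + 1) ρ β).real S := by
    rw [hind]
    exact integral_indicator_one hSm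
  rw [hexp]
  have hs : (0 : ℝ) ≤ β ^ (2 * δ - 1) := Real.rpow_nonneg hβ0.le _
  exact (hmain (L := L + 1) (by omega) β hβ1 _ hs (Torus.proj (L + 1) x) hij).trans (hasy β hβ)

/-- **L2, `∀ᶠ L` form** — literally the body of the line's predicate `PlaquetteLargeFieldRarity δ` (skeleton
`Lines/dlr-chessboard.lean` of crux `BulkDominatesColdBoxW`): for `0 < δ`, `∃ β₀, ∀ β ≥ β₀, ∀ᶠ L, ∀ x, ∀ i < j`,
`wilsonExpectation_{(L+1)⁴} 𝟙{β^{2δ−1} ≤ plaqCostAt ρ x i j} ≤ exp(−β^δ)`. [cite: FrohlichIsraelLiebSimon1978, Thm. 4.1] -/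
theorem plaquetteLargeFieldRarity_eventually {δ : ℝ} (hδ : 0 < δ) :
    ∃ β₀ : ℝ, ∀ β : ℝ, β₀ ≤ β → ∀ᶠ L : ℕ in atTop, ∀ (x : Literature.Probability.LatticeModels.Site 4) (i j : Fin 4), i < j →
      wilsonExpectation (L := L + 1) (fundamentalRep (Fin 2)) β
          (toTorusObservable (L + 1) fun U : LGConfig 4 (Matrix.specialUnitaryGroup (Fin 2) ℂ) =>
            if β ^ (2 * δ - 1) ≤ plaqCostAt (fundamentalRep (Fin 2)) x i j U then (1 : ℝ) else 0) ≤
        Real.exp (-(β ^ δ)) := by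
  obtain ⟨β₀, h⟩ := plaquetteLargeFieldRarity_allSides hδ
  refine ⟨β₀, fun β hβ => ?_⟩
  filter_upwards [eventually_ge_atTop 1] with L hL x i j hij
  exact h β hβ L hL x i j hij.ne

end Summit.QuantumFields.YangMills.Theorems.WeakCouplingRates
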